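import Summits.BirchSwinnertonDyer.BirchSwinnertonDyer.Theorems.QuadraticBranchSignedControlPlusEtaNonsurjCMRowsUniform
import Summits.BirchSwinnertonDyer.Rank1Residual.GaloisImage.AbelianNumberFieldTorsion
import Literature.NumberTheory.EllipticCurves.SupersingularIrreducibleProofs
import Literature.NumberTheory.EllipticCurves.BSDSelmerSmithCMTableProofs
import Literature.NumberTheory.EllipticCurves.IrreducibleModPQuadraticTwistProofs
import Literature.NumberTheory.EllipticCurves.HeegnerPointsKolyvaginExceptionalTwistProofs
import Summits.BirchSwinnertonDyer.Rank1Residual.X12.O11.RouteUTamagawaCM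
import Mathlib.AlgebraicGeometry.EllipticCurve.NormalForms
import HarnessLib

/-!
# Route `QuadraticBranchSignedControl` (rung K8, cell `bsd-potss`): crux stmt-BirchSwinnertonDyer-19606
# `PlusEtaMainConjectureNonsurj` — THE `j = 0` / `j = 1728` ROWS AS EXPLICIT FAMILIES (`y² = x³ + B` at `p ≡ 2 (mod 3)`,
# `y² = x³ + A x` at `p ≡ 3 (mod 4)`), and `V(L)[p] = 0` over every ABELIAN number field `L` for every row

WHAT. Sequel of `…CMRowsUniform` (this seat): there the `j = 0` (resp. `j = 1728`) rows of crux 19606 were characterised by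
`p ≡ 2 (mod 3)` (resp. `p ≡ 3 (mod 4)`). Here:

* §1 `j_eq_zero_iff_exists_sextic` / `j_eq_1728_iff_exists_quartic`: an elliptic curve over `ℚ` has `j = 0` (resp. `1728`) iff it is
  `ℚ`-isomorphic to `y² = x³ + B`, `B ≠ 0` (resp. `y² = x³ + A x`, `A ≠ 0`) — ⟹ is the tree's `exists_variableChange_eq_j_zero_model` /
  `exists_variableChange_eq_j1728_model` (`BSDSelmerSmithCMTableProofs`, reused, not restated); ⟸ (`j_eq_zero_of_variableChange_eq_sextic`,
  `j_eq_1728_of_variableChange_eq_quartic`) from Mathlib's `j = 6912 a₄³ / (4a₄³ + 27a₆²)` in short normal form.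
* §2 `cmRow_iff_of_sextic` / `cmRow_iff_of_quartic`: for `V` globally minimal, good at `p ≥ 5`, `ℚ`-isomorphic to `y² = x³ + B`
  (resp. `y² = x³ + A x`): `V` is a row iff `p ≡ 2 (mod 3)` (resp. `p ≡ 3 (mod 4)`); `row_of_j_eq_zero_iff_family` packages «the `j = 0`
  rows at `p` = the sextic family, and they exist iff `p ≡ 2 (mod 3)`». These are EXACTLY the populations of this seat's kit census
  at `p = 5, 11` (sextic) and `p = 7, 11` (quartic) and of g17's at `17`, i.e. the domains of v7's CM stubs on these two classes.
* §3 `torsionBy_eq_bot_of_row`: on EVERY row `V` of the crux (CM or not) and every ABELIAN number field `L/ℚ`, `V(L)[p] = 0` — in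
  particular over every layer `ℚ(μ_{p^{n+1}})` of `K_∞` and over `K_V(μ_{p^∞})`-layers: the hypothesis «`E(K_∞)[p] = 0`» of the
  signed-Selmer literature (control / no finite submodule: B.D. Kim 2013, Hatley–Lei 2019 Lemma 2.2) holds on the whole domain of 19606
  (rows are good supersingular, so `V[p]` is irreducible — Serre 1972 §1.11 — and the residual cell's `E(ℚ^{ab})[p] = 0`).

HONEST FRAMING (cell `bsd-potss`; FULL-BSD rank ≤ 1 programme): structure / bookkeeping theorems; no definition, no named fact, no `sorry`,
axioms standard. Nothing about (C1⁺_η), (A) or the analytic `μ` is proved; crux 19606 stays OPEN; `BSD(W, p)` is claimed for no pair.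
Seat `bsd-potss-k8eta-c2` g18 (prover), `--supports stmt-BirchSwinnertonDyer-19606`.

References: [SilvermanAEC2009] III.1 (short Weierstrass form, `j = 1728·4a₄³/Δ`), X.5 (twists of `j = 0, 1728`); [Serre1972] §1.11 Prop. 12,
§5.2 (iv); [Kim2013JAustMS] Prop. 3.? hypothesis `E(K_∞)[p] = 0`; [HatleyLei2019] Lemma 2.2; [Cremona1997] Table 1.
-/

set_option autoImplicit false
set_option linter.dupNamespace false

noncomputable section

open scoped Classical

open WeierstrassCurve Literature.NumberTheory.EllipticCurves Literature.NumberTheory.EllipticCurves.Rank1Residual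

namespace Summit.BirchSwinnertonDyer.BirchSwinnertonDyer.Theorems.EtaCartanField

/-! ## §1 Short normal forms of the two special `j`-classes -/

/-- In short normal form, `a₄ = 0 ⟹ j = 0`. [cite: SilvermanAEC2009, III.1] -/
theorem j_eq_zero_of_isShortNF_of_a₄_eq_zero (W : WeierstrassCurve ℚ) [W.IsElliptic] [W.IsShortNF] (h : W.a₄ = 0) : W.j = 0 := by
  rw [j_of_isShortNF, h]; simp

/-- In short normal form, `a₆ = 0 ⟹ j = 1728` (and then `a₄ ≠ 0`). [cite: SilvermanAEC2009, III.1] -/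
theorem j_eq_1728_of_isShortNF_of_a₆_eq_zero (W : WeierstrassCurve ℚ) [W.IsElliptic] [W.IsShortNF] (h : W.a₆ = 0) :
    W.j = 1728 := by
  have hΔ : W.Δ ≠ 0 := by rw [← coe_Δ']; exact W.Δ'.ne_zero
  rw [Δ_of_isShortNF, h] at hΔ
  have hden : 4 * W.a₄ ^ 3 + 27 * (0 : ℚ) ^ 2 ≠ 0 := right_ne_zero_of_mul hΔ
  rw [j_of_isShortNF, h, div_eq_iff hden]
  ring

/-- The sextic model `y² = x³ + B` is in short normal form. [folklore] -/
theorem isShortNF_sextic (B : ℚ) : (⟨0, 0, 0, 0, B⟩ : WeierstrassCurve ℚ).IsShortNF := ⟨rfl, rfl, rfl⟩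

/-- The quartic model `y² = x³ + A x` is in short normal form. [folklore] -/
theorem isShortNF_quartic (A : ℚ) : (⟨0, 0, 0, A, 0⟩ : WeierstrassCurve ℚ).IsShortNF := ⟨rfl, rfl, rfl⟩

/-- **`j(C • V) = 0` whenever `C • V = (y² = x³ + B)`** — stated on `V` (the `j`-invariant is `ℚ`-isomorphism invariant).
[cite: SilvermanAEC2009, III.1] -/
theorem j_eq_zero_of_variableChange_eq_sextic (V : WeierstrassCurve ℚ) [V.IsElliptic] {C : VariableChange ℚ} {B : ℚ}
    (hC : C • V = ⟨0, 0, 0, 0, B⟩) : V.j = 0 := by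
  haveI : (C • V).IsShortNF := by rw [hC]; exact isShortNF_sextic B
  have h4 : (C • V).a₄ = 0 := by rw [hC]
  rw [← variableChange_j V C]
  exact j_eq_zero_of_isShortNF_of_a₄_eq_zero (C • V) h4

/-- **`j(V) = 1728` whenever `C • V = (y² = x³ + A x)`.** [cite: SilvermanAEC2009, III.1] -/
theorem j_eq_1728_of_variableChange_eq_quartic (V : WeierstrassCurve ℚ) [V.IsElliptic] {C : VariableChange ℚ} {A : ℚ}
    (hC : C • V = ⟨0, 0, 0, A, 0⟩) : V.j = 1728 := by
  haveI : (C • V).IsShortNF := by rw [hC]; exact isShortNF_quartic A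
  have h6 : (C • V).a₆ = 0 := by rw [hC]
  rw [← variableChange_j V C]
  exact j_eq_1728_of_isShortNF_of_a₆_eq_zero (C • V) h6

/-- **`j(V) = 0` iff `V ≅_ℚ y² = x³ + B` for some `B ≠ 0`.** [cite: SilvermanAEC2009, III.1 and X.5] -/
theorem j_eq_zero_iff_exists_sextic (V : WeierstrassCurve ℚ) [V.IsElliptic] :
    V.j = 0 ↔ ∃ (C : VariableChange ℚ) (B : ℚ), B ≠ 0 ∧ C • V = ⟨0, 0, 0, 0, B⟩ :=
  ⟨exists_variableChange_eq_j_zero_model V, fun ⟨_, _, _, hC⟩ => j_eq_zero_of_variableChange_eq_sextic V hC⟩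

/-- **`j(V) = 1728` iff `V ≅_ℚ y² = x³ + A x` for some `A ≠ 0`.** [cite: SilvermanAEC2009, III.1 and X.5] -/
theorem j_eq_1728_iff_exists_quartic (V : WeierstrassCurve ℚ) [V.IsElliptic] :
    V.j = 1728 ↔ ∃ (C : VariableChange ℚ) (A : ℚ), A ≠ 0 ∧ C • V = ⟨0, 0, 0, A, 0⟩ :=
  ⟨exists_variableChange_eq_j1728_model V, fun ⟨_, _, _, hC⟩ => j_eq_1728_of_variableChange_eq_quartic V hC⟩

/-! ## §2 The rows on the two classes = the sextic / quartic families -/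

/-- **THE SEXTIC ROWS.** For `V/ℚ` globally minimal, good at `p ≥ 5`, with `C • V = (y² = x³ + B)` for some `ℚ`-isomorphism `C`:
`V` is a row of crux 19606 (`a_p(V) = 0`, tower not onto) iff `p ≡ 2 (mod 3)`. [cite: Lang1987, Ch. 13 §4 Thm. 12] [cite: SilvermanAEC2009, X.5] -/
theorem cmRow_iff_of_sextic (V : WeierstrassCurve ℚ) [V.IsElliptic] [V.IsGloballyMinimal] {C : VariableChange ℚ} {B : ℚ}
    (hC : C • V = ⟨0, 0, 0, 0, B⟩) (p : ℕ) [Fact p.Prime] (hp5 : 5 ≤ p) (hgood : V.HasGoodReductionAtPrime p) :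
    (V.frobeniusTrace p = 0 ∧ ¬ ∀ m : ℕ, V.HasSurjectiveModNGaloisRep (p ^ m : ℕ)) ↔ p % 3 = 2 := by
  exact cmRow_iff_of_j_eq_zero V (j_eq_zero_of_variableChange_eq_sextic V hC) p hp5 hgood

/-- **THE QUARTIC ROWS.** For `V/ℚ` globally minimal, good at `p ≥ 5`, with `C • V = (y² = x³ + A x)`: `V` is a row of crux 19606 iff
`p ≡ 3 (mod 4)`. [cite: Lang1987, Ch. 13 §4 Thm. 12] [cite: SilvermanAEC2009, X.5] -/
theorem cmRow_iff_of_quartic (V : WeierstrassCurve ℚ) [V.IsElliptic] [V.IsGloballyMinimal] {C : VariableChange ℚ} {A : ℚ}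
    (hC : C • V = ⟨0, 0, 0, A, 0⟩) (p : ℕ) [Fact p.Prime] (hp5 : 5 ≤ p) (hgood : V.HasGoodReductionAtPrime p) :
    (V.frobeniusTrace p = 0 ∧ ¬ ∀ m : ℕ, V.HasSurjectiveModNGaloisRep (p ^ m : ℕ)) ↔ p % 4 = 3 := by
  exact cmRow_iff_of_j_eq_1728 V (j_eq_1728_of_variableChange_eq_quartic V hC) p hp5 hgood

/-- **The `j = 0` rows at `p ≥ 5` are EXACTLY the globally minimal curves, good at `p`, `ℚ`-isomorphic to some `y² = x³ + B` (`B ≠ 0`),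
and such rows exist iff `p ≡ 2 (mod 3)`** — the population of the CM stubs of skeleton v7 on this class, as computed by the lineage's kit
(«etasextic» at `17`, «etacm» sextic families at `5, 11`). [cite: Lang1987, Ch. 13 §4 Thm. 12] [cite: SilvermanAEC2009, X.5] -/
theorem row_and_j_eq_zero_iff_sextic (V : WeierstrassCurve ℚ) [V.IsElliptic] [V.IsGloballyMinimal] (p : ℕ) [Fact p.Prime] (hp5 : 5 ≤ p)
    (hgood : V.HasGoodReductionAtPrime p) :
    (V.frobeniusTrace p = 0 ∧ ¬ (∀ m : ℕ, V.HasSurjectiveModNGaloisRep (p ^ m : ℕ)) ∧ V.j = 0) ↔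
      (p % 3 = 2 ∧ ∃ (C : VariableChange ℚ) (B : ℚ), B ≠ 0 ∧ C • V = ⟨0, 0, 0, 0, B⟩) := by
  rw [← j_eq_zero_iff_exists_sextic]
  constructor
  · rintro ⟨hap, hns, hj⟩
    exact ⟨(cmRow_iff_of_j_eq_zero V hj p hp5 hgood).mp ⟨hap, hns⟩, hj⟩
  · rintro ⟨h3, hj⟩
    obtain ⟨hap, hns⟩ := (cmRow_iff_of_j_eq_zero V hj p hp5 hgood).mpr h3
    exact ⟨hap, hns, hj⟩

/-- **The `j = 1728` rows at `p ≥ 5` are EXACTLY the globally minimal curves, good at `p`, `ℚ`-isomorphic to some `y² = x³ + A x`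
(`A ≠ 0`), and such rows exist iff `p ≡ 3 (mod 4)`** («etacm» quartic families at `7, 11`). [cite: Lang1987, Ch. 13 §4 Thm. 12]
[cite: SilvermanAEC2009, X.5] -/
theorem row_and_j_eq_1728_iff_quartic (V : WeierstrassCurve ℚ) [V.IsElliptic] [V.IsGloballyMinimal] (p : ℕ) [Fact p.Prime]
    (hp5 : 5 ≤ p) (hgood : V.HasGoodReductionAtPrime p) :
    (V.frobeniusTrace p = 0 ∧ ¬ (∀ m : ℕ, V.HasSurjectiveModNGaloisRep (p ^ m : ℕ)) ∧ V.j = 1728) ↔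
      (p % 4 = 3 ∧ ∃ (C : VariableChange ℚ) (A : ℚ), A ≠ 0 ∧ C • V = ⟨0, 0, 0, A, 0⟩) := by
  rw [← j_eq_1728_iff_exists_quartic]
  constructor
  · rintro ⟨hap, hns, hj⟩
    exact ⟨(cmRow_iff_of_j_eq_1728 V hj p hp5 hgood).mp ⟨hap, hns⟩, hj⟩
  · rintro ⟨h4, hj⟩
    obtain ⟨hap, hns⟩ := (cmRow_iff_of_j_eq_1728 V hj p hp5 hgood).mpr h4
    exact ⟨hap, hns, hj⟩

/-! ## §3 `V(L)[p] = 0` over abelian number fields, on every row -/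

/-- **`V[p]` is irreducible on every row of crux 19606** (good supersingular at `p ≥ 5`; Serre 1972 §1.11, the tree theorem
`hasIrreducibleModPGaloisRep_of_dvd_frobeniusTrace`). The non-onto hypothesis is not used. [cite: Serre1972, §1.11 Prop. 12] -/
theorem hasIrreducibleModPGaloisRep_of_goodSS_row (V : WeierstrassCurve ℚ) [V.IsElliptic] [V.IsGloballyMinimal] (p : ℕ) [Fact p.Prime]
    (hp5 : 5 ≤ p) (hgood : V.HasGoodReductionAtPrime p) (hap : V.frobeniusTrace p = 0) : V.HasIrreducibleModPGaloisRep p :=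
  hasIrreducibleModPGaloisRep_of_dvd_frobeniusTrace V p (by omega)
    (V.not_dvd_minimalDiscriminantInt_of_hasGoodReductionAtPrime' p hgood) (by rw [hap]; exact dvd_zero _)

/-- **`V(L)[p] = 0` for every ABELIAN number field `L/ℚ` on every row of crux 19606** (`p ≥ 5`, good supersingular): no point of order `p`
of `V` is defined over an abelian extension of `ℚ` — in particular over any layer `ℚ(μ_{p^{n+1}})` of `K_∞ = ℚ(μ_{p^∞})`, over the
Cartan field `K_V`, or over their compositum. This is the standing hypothesis «`E(K_∞)[p] = 0`» of the signed-Selmer control /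
no-finite-submodule results used around Kobayashi's main conjecture at `η`. (Irreducibility §3 + the residual cell's
`torsionBy_eq_bot_of_isAbelianGalois`.) [cite: Serre1972, §5.2 (iv) and §5.4] [cite: HatleyLei2019, Lemma 2.2] -/
theorem torsionBy_eq_bot_of_row (V : WeierstrassCurve ℚ) [V.IsElliptic] [V.IsGloballyMinimal] (p : ℕ) [Fact p.Prime] (hp5 : 5 ≤ p)
    (hgood : V.HasGoodReductionAtPrime p) (hap : V.frobeniusTrace p = 0)
    (L : Type) [Field L] [NumberField L] [IsAbelianGalois ℚ L] :
    AddSubgroup.torsionBy (V.baseChange L).toAffine.Point (p : ℤ) = ⊥ :=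
  Summit.BirchSwinnertonDyer.Rank1Residual.GaloisImage.torsionBy_eq_bot_of_isAbelianGalois_type V p L (by omega)
    (hasIrreducibleModPGaloisRep_of_goodSS_row V p hp5 hgood hap)

/-! ## §4 (appended, k8eta-c2 g18) The additive PARTNER `W` (`C • W^{(p*)} = V`): `W[p]` irreducible, `W(L)[p] = 0` over abelian `L` -/

/-- **The partner's `W[p]` is irreducible on every row.** For `V` a row at `p ≥ 5` (good supersingular) and `W` with
`C • W.quadraticTwist p* = V` (`p* = (−1)^{(p−1)/2} p`): `W[p] ≅ V[p] ⊗ χ_{p*}` is irreducible (twist invariance of irreducibility, tree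
theorem `hasIrreducibleModPGaloisRep_iff_of_smul_eq_quadraticTwist`; §3). [cite: SilvermanAEC2009, X.5 Cor. 5.4] [cite: Serre1972, §1.11 Prop. 12] -/
theorem hasIrreducibleModPGaloisRep_partner_of_row (V : WeierstrassCurve ℚ) [V.IsElliptic] [V.IsGloballyMinimal] (W : WeierstrassCurve ℚ)
    [W.IsElliptic] (C : VariableChange ℚ) (p : ℕ) [Fact p.Prime] (hp5 : 5 ≤ p)
    (hCV : C • W.quadraticTwist ((-1) ^ (p / 2) * p) = V) (hgood : V.HasGoodReductionAtPrime p) (hap : V.frobeniusTrace p = 0) :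
    W.HasIrreducibleModPGaloisRep p := by
  have hp0 : ((-1 : ℚ) ^ (p / 2) * p) ≠ 0 :=
    mul_ne_zero (pow_ne_zero _ (by norm_num)) (by exact_mod_cast (Fact.out : p.Prime).ne_zero)
  have hC' : C⁻¹ • V = W.quadraticTwist ((-1) ^ (p / 2) * p) := by rw [← hCV, inv_smul_smul]
  exact (hasIrreducibleModPGaloisRep_iff_of_smul_eq_quadraticTwist W V hp0 hC' p).mp
    (hasIrreducibleModPGaloisRep_of_goodSS_row V p hp5 hgood hap)

/-- **`W(L)[p] = 0` over every ABELIAN number field `L/ℚ` for the additive partner `W` of every row** (`C • W^{(p*)} = V`, `V` good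
supersingular at `p ≥ 5` with `a_p = 0`): in particular `W` has no `p`-torsion over any layer `ℚ(μ_{p^{n+1}})` of the cyclotomic tower
(the hypothesis «`E(ℚ_∞)[p] = 0`» for Kato's main conjecture of `W` over `ℚ_∞` — the `η`-component dictionary of the node). (§4 + the residual
cell's `torsionBy_eq_bot_of_isAbelianGalois`.) [cite: Serre1972, §5.2 (iv) and §5.4] [cite: HatleyLei2019, Lemma 2.2] -/
theorem torsionBy_eq_bot_of_partner_of_row (V : WeierstrassCurve ℚ) [V.IsElliptic] [V.IsGloballyMinimal] (W : WeierstrassCurve ℚ)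
    [W.IsElliptic] (C : VariableChange ℚ) (p : ℕ) [Fact p.Prime] (hp5 : 5 ≤ p)
    (hCV : C • W.quadraticTwist ((-1) ^ (p / 2) * p) = V) (hgood : V.HasGoodReductionAtPrime p) (hap : V.frobeniusTrace p = 0)
    (L : Type) [Field L] [NumberField L] [IsAbelianGalois ℚ L] :
    AddSubgroup.torsionBy (W.baseChange L).toAffine.Point (p : ℤ) = ⊥ :=
  Summit.BirchSwinnertonDyer.Rank1Residual.GaloisImage.torsionBy_eq_bot_of_isAbelianGalois_type W p L (by omega)
    (hasIrreducibleModPGaloisRep_partner_of_row V W C p hp5 hCV hgood hap)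

/-! ## §5 (appended, k8eta-c2 g18) The partner of a CM row: CM with the same `j`, Tamagawa product prime to `p` -/

/-- The `j`-invariant is insensitive to the (Prop-valued) `IsElliptic` witness and to equality of curves. [folklore] -/
private theorem j_congr_eq {W₁ W₂ : WeierstrassCurve ℚ} [h₁ : W₁.IsElliptic] [h₂ : W₂.IsElliptic] (h : W₁ = W₂) : W₁.j = W₂.j := by
  subst h; rfl

/-- **The partner has the same `j`**: `C • W^{(p*)} = V ⟹ j(W) = j(V)`. [cite: SilvermanAEC2009, III.1.4(b) and X.5] -/
theorem j_partner_eq (V : WeierstrassCurve ℚ) [V.IsElliptic] (W : WeierstrassCurve ℚ) [W.IsElliptic] (C : VariableChange ℚ) (p : ℕ)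
    [Fact p.Prime] (hCV : C • W.quadraticTwist ((-1) ^ (p / 2) * p) = V) : W.j = V.j := by
  have hp0 : ((-1 : ℚ) ^ (p / 2) * p) ≠ 0 :=
    mul_ne_zero (pow_ne_zero _ (by norm_num)) (by exact_mod_cast (Fact.out : p.Prime).ne_zero)
  haveI := W.isElliptic_quadraticTwist hp0
  rw [← W.j_quadraticTwist hp0, ← variableChange_j (W.quadraticTwist ((-1) ^ (p / 2) * p)) C]
  exact j_congr_eq hCV

/-- **The partner of a CM row is CM** (same `j`). [cite: SilvermanAEC2009, III.1.4(b)] -/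
theorem hasCM_partner_iff (V : WeierstrassCurve ℚ) [V.IsElliptic] (W : WeierstrassCurve ℚ) [W.IsElliptic] (C : VariableChange ℚ) (p : ℕ)
    [Fact p.Prime] (hCV : C • W.quadraticTwist ((-1) ^ (p / 2) * p) = V) : W.HasCM ↔ V.HasCM :=
  hasCM_iff_of_j_eq (j_partner_eq V W C p hCV)

/-- **For a CM row, `p ∤ Tam(W)` for the additive partner `W`** (`p ≥ 5`; a CM curve has integral `j`, hence no multiplicative place, and
additive places have `c_v ≤ 4` — the residual cell's `RouteU.not_dvd_tamagawaProduct_of_hasCM`). Together with §4 (`W(ℚ)[p] = 0`) this is why,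
on the CM populations, `v_p(L(W,1)/Ω_W) = v_p(#Ш(W)_an)`: the reading of prediction P5 of the seat's census («`λ⁺_η(V) = 0 ⟺ p ∤ #Ш(W)_an`»).
[cite: SilvermanAEC2009, VII.6.1 and C.15 (Kodaira–Néron table)] [cite: SilvermanAdvancedTopics1994, II.6 (integrality of CM j)] -/
theorem not_dvd_tamagawaProduct_partner_of_cmRow (V : WeierstrassCurve ℚ) [V.IsElliptic] (W : WeierstrassCurve ℚ) [W.IsElliptic]
    (C : VariableChange ℚ) (p : ℕ) [Fact p.Prime] (hp5 : 5 ≤ p) (hCV : C • W.quadraticTwist ((-1) ^ (p / 2) * p) = V) (hCM : V.HasCM) :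
    ¬ p ∣ W.tamagawaProduct :=
  Summit.BirchSwinnertonDyer.Rank1Residual.X12.O11.RouteU.not_dvd_tamagawaProduct_of_hasCM W ((hasCM_partner_iff V W C p hCV).mpr hCM) p
    Fact.out hp5

end Summit.BirchSwinnertonDyer.BirchSwinnertonDyer.Theorems.EtaCartanField

end
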